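import Summits.HodgeConjecture.HodgeConjecture.Theorems.Ring2HypothesesDescentAbsolutePrimitive
import Summits.HodgeConjecture.HodgeConjecture.Theorems.Ring2BindersAbelianSchemeVHCPrimitiveMiddleLift
import HarnessLib

/-!
# Ring 2 — hypotheses layer, descent axis: ABSOLUTE HODGE CLASSES ARE STABLE UNDER THE LEFSCHETZ OPERATOR OF EVERY
# POLARISATION — IN EVERY DEGREE — modulo Deligne's Ex. 2.1 (c) and pull-back functoriality only

HONEST FRAMING (page 1, verbatim the cell's standing line): **research route conditional on HC_CM; not a
corollary; Q11.4-sentence-2 already refuted in dim ≥ 3.** Nothing in this file proves a case of the Hodge conjecture;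
nothing discharges the binder of record b06 `Ring2.Hypotheses.AbsoluteHodgeImpliesAlgebraicAV` ("absolute Hodge classes
on complex abelian varieties are algebraic", `Ring2HypothesesDescent.lean` :73; OPEN, `≡ HC_AV` modulo Deligne's Main
Theorem 2.11 = fact c1); the binder table's numbers do not move. `HC_CM` (`Theses.RankFourFaces.CMAbelianHodge`) does not
occur in this file; `HC_AV` is not asserted.

Hodge ladder STAGE 3, `BINDER-OWNERS.md` row **b06**, seat `ring2-b06` (gen 71), third file of the gen. Gen 70 proved
`ηᴺ ∪ x` absolute Hodge for `N ≥ n − 2p` ONLY and recorded the band `0 < N < n − 2p` as out of reach of the tree's tools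
((c) = c34 `deligne1982_lefschetz_absoluteHodge_iff` at the hard Lefschetz exponent, pull-backs modulo (N)
`chartConjugation_canonical` + (E) existence of conjugates) — "needs Charles–Schnell Prop. 11.2.7 / 11.2.8 (1)". The first
two files of this gen (`…AbsolutePrimitive`, `…AbsolutePrimitiveRow`) got the Lefschetz-PRIMITIVE COMPONENT of an absolute
Hodge class by a product with one polarised curve. **This file removes the threshold altogether: for every polarisation
class `η` of a smooth projective `X`, every absolute Hodge class `a` and every `N`, `ηᴺ ∪ a` is absolute Hodge — modulo
(N)+(E)+(c) and nothing else.** In print this is the instance "`L = ∪ [H]`" of Charles–Schnell Prop. 11.2.7 + 11.2.8 (1)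
(cup product / algebraic correspondences are absolute Hodge); here it follows from Cor. 11.2.12 = Deligne Ex. 2.1 (c) alone.

THE ARGUMENT. Let `c ∈ P^{2p}(X, η)` be a PRIMITIVE absolute Hodge class, `j = n − 2p ≥ 1`, `E` a polarised elliptic
curve (`κ`, `κ ∪ κ = 0`), `θ = pr_X^* η + pr_E^* κ` on `X × E`, and `v(c) = pr_X^*(η ∪ c) − j · pr_X^* c ∪ pr_E^* κ` ring2-b02's
PRIMITIVE ONE-STEP LIFT (gen 36, `primitiveLift_mem_primitiveClasses`: `v(c) ∈ P^{2p+2}(X × E, θ)`; count once THEIRS).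
(1) `*c = ηʲ ∪ c` is absolute Hodge ((c) on `X`), hence so is `W = pr_X^*(ηʲ ∪ c)`. (2) The class
`Z = pr_X^*(η ∪ c) − (j−1) · pr_X^* c ∪ pr_E^* κ ∈ H^{2p+2}((X × E)(ℂ); ℂ)` satisfies `θ^{j−1} ∪ Z = W` (binomial theorem with
`κ² = 0` and `η^{j+1} ∪ c = 0`), and `j − 1` IS the hard Lefschetz exponent of the `(n+1)`-fold `X × E` in degree `2p + 2`:
so `Z` is absolute Hodge by (c) read from right to left. (3) `(j+1) · Z = j · v(c) + θ ∪ pr_X^* c` with `v(c)` primitive: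
by the first file's `isAbsoluteHodgeClass_primitiveComponent_of_canonical` (applied on `X × E`), `j · v(c)` and hence `v(c)`
is absolute Hodge. (4) Restrict `v(c)` to the slice `X × {t}`: `pr_E^* κ ↦ 0`, so **`η ∪ c` is absolute Hodge**. (5) Induction
over `X × E`: `v(c)` is again primitive absolute Hodge, so `θⁱ ∪ v(c)` is absolute Hodge by the induction hypothesis ON
`X × E`, and its slice is `η^{i+1} ∪ c`. (6) A general absolute Hodge class is `a = a₀ + η ∪ a'` with `a₀` primitive and
`a'` absolute Hodge of lower degree (first file): strong induction on the degree.

* §0 Two bridges between ring2-b02's `lefschetzOperator` spelling and the first file's `cupProduct` spelling.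
* §1 **`isAbsoluteHodgeClass_primitiveLift_of_mem_primitiveClasses_of_canonical`** — steps (1)–(3): b02's lift of a
  primitive absolute Hodge class is absolute Hodge (coefficient = the defect `j`).
* §2 **`isAbsoluteHodgeClass_lefschetzPowTo_of_mem_primitiveClasses_of_canonical`** — steps (4)–(5): `ηⁱ ∪ c` for primitive `c`,
  every `i`; **`isAbsoluteHodgeClass_lefschetzPowTo_all_of_canonical`** — step (6): `ηᴺ ∪ a` for EVERY absolute Hodge `a`,
  every `N` (gen 70's theorem without its hypothesis `n ≤ 2p + N`); `isAbsoluteHodgeClass_cupProduct_polarization_of_canonical` (`N = 1`).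
* §3 COROLLARIES: the exterior product `pr_X^* a ∪ pr_T^* κ` with a polarisation class of ANY smooth projective `T` is
  absolute Hodge (`isAbsoluteHodgeClass_cross_polarization_of_canonical`); b02's lift `L_{pr₁^*η} pr₁^*a − s · L_{pr₂^*κ} pr₁^*a`
  is absolute Hodge for EVERY absolute Hodge `a` and every coefficient `s : ℕ` (`isAbsoluteHodgeClass_primitiveLift_of_canonical`)
  — the input the defect induction of AbelianAll XXVIII needs on the absolute axis (fourth file of the gen).

HONEST COLUMN. Nothing is discharged; row b06, the general row, `HC_AV` stay OPEN and are NOT asserted; (N), (E), (c) are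
named facts of the tree occurring only as hypotheses; no new definition, no new named fact, no sorry. NOT obtained: cup
product with an absolute Hodge class that is NOT (a pull-back of) a polarisation class — Charles–Schnell 11.2.7 in
general — and Gysin stability; the middle-degree form of the GENERAL row therefore still needs `B(X)` (gen 70 §4).

PRESEARCH: «absolute Hodge classes stable under Lefschetz operator / cup product with hyperplane class» → in print
Charles–Schnell Prop. 11.2.7, 11.2.8 (1), Cor. 11.2.12 [corpus: book:cattani2014-hodge-theory-princeton-mathematical-notes-49
pp. 468–471]; Deligne 1982 Ex. 2.1 (c), (d) [corpus: book:deligne1982 re-ed. p. 16]; a derivation of the full statement from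
Cor. 11.2.12 alone (products with curves) not found in either corpus — proof device for the tree's toolset, no novelty
claimed in print.

References (bib keys): Deligne1982HodgeCycles (§2 Ex. 2.1 (c), (d) p. 16), CharlesSchnell2014Notes (§11.2.2 (11.2.2),
Def. 11.2.3, Prop. 11.2.7, Prop. 11.2.8, Cor. 11.2.12, Lemma 11.2.13 — PDF pp. 464–471), VoisinHodgeI2002 (§6.2.3 Def. 6.24,
Thm. 6.25, Cor. 6.26, Rem. 6.27, §7.1.2), Kleiman1968AlgebraicCycles (§1.4 (1.4.6), Thm. 2.9), Andre1996Motifs (§1.3),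
HatcherAT2002 (§3.2 Prop. 3.10, Thm. 3.11, Thm. 3.15), Fulton1998 (§10.1), MumfordAV1970 (§1). -/

noncomputable section

set_option linter.dupNamespace false

open CategoryTheory AlgebraicGeometry MonoidalCategory CartesianMonoidalCategory
open Literature.AlgebraicTopology.SingularHomology Literature.Geometry.Kaehler
open Literature.AlgebraicGeometry Literature.AlgebraicGeometry.Motives
open Literature.AlgebraicGeometry.HodgeTheory
open Summit.HodgeConjecture.HodgeConjecture.Theorems
open Summit.HodgeConjecture.HodgeConjecture.Ring2.Binders (primitiveLift_mem_primitiveClasses map_lefschetzOperator)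

namespace Summit.HodgeConjecture.HodgeConjecture.Ring2.Hypotheses

/-! ## §0 Bridges: ring2-b02's `lefschetzOperator` spelling of the lift vs the `cupProduct` spelling of the first file -/

section Bridges

variable {X T : SchemeOver ℂ} (η : complexBetti X 2) (κ : complexBetti T 2)

/-- `L_{pr_X^* η} (pr_X^* b) = pr_X^* (L_η b)` (naturality of the cup product). [cite: HatcherAT2002, §3.2 Prop. 3.10] -/
theorem lefschetzOperator_map_fst_map_fst {k l : ℕ} (h : 2 + k = l) (hl : k + 2 * 1 = l) (b : complexBetti X k) :
    lefschetzOperator (complexBetti.map (fst X T) 2 η) h (complexBetti.map (fst X T) k b) =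
      complexBetti.map (fst X T) l (lefschetzPowTo η 1 k l hl b) := by
  rw [lefschetzOperator_apply, ← cupProduct_map, lefschetzPowTo_one_eq_cupProduct η hl h]

/-- `L_{pr_T^* κ} (pr_X^* b) = pr_X^* b ∪ pr_T^* κ` (graded commutativity, the sign `(-1)^{2k}` being `+1`).
[cite: HatcherAT2002, §3.2 Thm. 3.11] -/
theorem lefschetzOperator_map_snd_map_fst {k l : ℕ} (h : 2 + k = l) (h' : k + 2 = l) (b : complexBetti X k) :
    lefschetzOperator (complexBetti.map (snd X T) 2 κ) h (complexBetti.map (fst X T) k b) =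
      cupProduct h' (complexBetti.map (fst X T) k b) (complexBetti.map (snd X T) 2 κ) := by
  rw [lefschetzOperator_apply, cupProduct_gradedComm_holds ℂ (ComplexPoints (X ⊗ T)) h h',
    Even.neg_one_pow (even_two_mul k), one_smul]

end Bridges

/-! ## §1 ring2-b02's primitive one-step lift of a PRIMITIVE absolute Hodge class is absolute Hodge -/

section Lift

variable {n : ℕ} {X : SchemeOver ℂ}

/-- **THE PRIMITIVE ONE-STEP LIFT OF A PRIMITIVE ABSOLUTE HODGE CLASS IS ABSOLUTE HODGE** (modulo (N), (E) and
Deligne's Ex. 2.1 (c)). `X` smooth projective of dimension `n = 2p + j`, `η` a polarisation class, `c ∈ P^{2p}(X, η)`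
absolute Hodge; `E` a complex abelian variety of dimension `1` with a polarisation class `κ`. Then ring2-b02's lift
`v(c) = L_{pr_X^*η} pr_X^* c − j · L_{pr_E^*κ} pr_X^* c ∈ H^{2p+2}((X × E)(ℂ); ℂ)` is absolute Hodge on the `(n+1)`-fold `X × E`.
For `j = 0` this is the pull-back of `η ∪ c` (gen 70); for `j ≥ 1` it is steps (1)–(3) of the module docstring:
`Z = pr_X^*(η c) − (j−1) · pr_X^* c ∪ pr_E^* κ` has `θ^{j−1} Z = pr_X^*(ηʲ c)` absolute Hodge, so `Z` is ((c) from right to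
left on `X × E`), and `(j+1) Z = j · v(c) + θ ∪ pr_X^* c` exhibits `j · v(c)` as the θ-primitive component of an absolute
Hodge class (`primitiveLift_mem_primitiveClasses`, ring2-b02; `isAbsoluteHodgeClass_primitiveComponent_of_canonical`).
[cite: Deligne1982HodgeCycles, §2 Example 2.1 (c), (d) (p. 16)] [cite: Kleiman1968AlgebraicCycles, §1.4 (1.4.6)]
[cite: VoisinHodgeI2002, §6.2.3 Def. 6.24, Thm. 6.25 and Cor. 6.26] -/
theorem isAbsoluteHodgeClass_primitiveLift_of_mem_primitiveClasses_of_canonical (hN : chartConjugation_canonical)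
    (hex : ∀ ⦃n : ℕ⦄ ⦃X : SchemeOver ℂ⦄, IsSmoothProjective n X →
      ∀ (σ : ℂ ≃+* ℂ) (p : ℕ) (c : complexBetti X (2 * p)), ∃ s, IsConjugateClass σ X (2 * p) c s)
    (h21c : deligne1982_lefschetz_absoluteHodge_iff) (hX : IsSmoothProjective n X) {η : complexBetti X 2}
    (hη : IsPolarizationClass n X η) (E : AbelianVariety ℂ) (hE1 : E.dim = 1) {κ : complexBetti E.X 2}
    (hκ : IsPolarizationClass E.dim E.X κ) {p j : ℕ} (hj : 2 * p + j = n) {c : complexBetti X (2 * p)}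
    (hc : c ∈ primitiveClasses η n (2 * p)) (hAH : IsAbsoluteHodgeClass n X p c) :
    IsAbsoluteHodgeClass (n + E.dim) (X ⊗ E.X) (p + 1)
      (lefschetzOperator (complexBetti.map (fst X E.X) 2 η) (two_add_two_mul p) (complexBetti.map (fst X E.X) (2 * p) c) -
        ((j : ℕ) : ℂ) • lefschetzOperator (complexBetti.map (snd X E.X) 2 κ) (two_add_two_mul p)
          (complexBetti.map (fst X E.X) (2 * p) c)) := by
  have hEsp : IsSmoothProjective E.dim E.X := AbelianVariety.isSmoothProjective_holds (A := E)
  have hXE : IsSmoothProjective (n + E.dim) (X ⊗ E.X) := IsSmoothProjective.tensor_holds hX hEsp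
  have hθ := isPolarizationClass_boxSum hX hEsp hη hκ
  have hexXE : ∀ (q : ℕ) (σ : ℂ ≃+* ℂ) (d : complexBetti (X ⊗ E.X) (2 * q)),
      ∃ s, IsConjugateClass σ (X ⊗ E.X) (2 * q) d s := fun q σ d ↦ hex hXE σ q d
  rcases Nat.eq_zero_or_pos j with rfl | hj1
  · -- `j = 0`: the coefficient vanishes and `η ∪ c` is absolute Hodge by gen 70 (`n ≤ 2p + 1`)
    rw [Nat.cast_zero, zero_smul, sub_zero, lefschetzOperator_map_fst_map_fst η (two_add_two_mul p) (by omega)]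
    exact absolutePullback_of_canonical hN hex hXE hX (fst X E.X) (p + 1) _
      (isAbsoluteHodgeClass_lefschetzPowTo_of_canonical hN hex h21c hX hη (N := 1) (by omega) rfl (by omega) hAH)
  · obtain ⟨i, rfl⟩ : ∃ i, j = i + 1 := ⟨j - 1, by omega⟩
    have hκκ : cupProduct (rfl : 2 + 2 = 4) κ κ = 0 := by
      haveI := subsingleton_complexBetti hEsp (k := 4) (by omega)
      exact Subsingleton.elim _ _
    -- (1)+(2) `Z = pr_X^*(η c) − i · pr_X^* c ∪ pr_E^* κ` is absolute Hodge
    have hZ : IsAbsoluteHodgeClass (n + E.dim) (X ⊗ E.X) (p + 1)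
        (complexBetti.map (fst X E.X) (2 * (p + 1)) (lefschetzPowTo η 1 (2 * p) (2 * (p + 1)) (by omega) c) -
          (i : ℂ) • cupProduct (show 2 * p + 2 = 2 * (p + 1) by omega) (complexBetti.map (fst X E.X) (2 * p) c)
            (complexBetti.map (snd X E.X) 2 κ)) := by
      rcases Nat.eq_zero_or_pos i with rfl | hi1
      · -- `j = 1`: `Z = pr_X^*(η c)`, and `η c` is absolute Hodge by gen 70 (`n = 2p + 1`)
        rw [Nat.cast_zero, zero_smul, sub_zero]
        exact absolutePullback_of_canonical hN hex hXE hX (fst X E.X) (p + 1) _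
          (isAbsoluteHodgeClass_lefschetzPowTo_of_canonical hN hex h21c hX hη (N := 1) (by omega) rfl (by omega) hAH)
      · obtain ⟨N, rfl⟩ : ∃ N, i = N + 1 := ⟨i - 1, by omega⟩
        obtain ⟨q, hq⟩ : ∃ q, p + (N + 1 + 1) = q := ⟨_, rfl⟩
        have h2q : 2 * p + 2 * (N + 1 + 1) = 2 * q := by omega
        -- (1) `W = pr_X^*(η^{j} c)` is absolute Hodge
        have hW : IsAbsoluteHodgeClass (n + E.dim) (X ⊗ E.X) q
            (complexBetti.map (fst X E.X) (2 * q) (lefschetzPowTo η (N + 1 + 1) (2 * p) (2 * q) h2q c)) := by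
          refine absolutePullback_of_canonical hN hex hXE hX (fst X E.X) q _ ?_
          have h := (h21c hX hη p (N + 1 + 1) q (by omega) hq c).1 hAH
          rwa [← lefschetzPowTo_eq_degCast] at h
        -- (2) `θ^{j-1} Z = W` (binomial theorem, `κ² = 0`, `η^{j+1} c = 0`)
        have hZW : lefschetzPowTo (complexBetti.map (fst X E.X) 2 η + complexBetti.map (snd X E.X) 2 κ) (N + 1)
              (2 * (p + 1)) (2 * q) (by omega)
              (complexBetti.map (fst X E.X) (2 * (p + 1)) (lefschetzPowTo η 1 (2 * p) (2 * (p + 1)) (by omega) c) -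
                ((N + 1 : ℕ) : ℂ) • cupProduct (show 2 * p + 2 = 2 * (p + 1) by omega)
                  (complexBetti.map (fst X E.X) (2 * p) c) (complexBetti.map (snd X E.X) 2 κ)) =
            complexBetti.map (fst X E.X) (2 * q) (lefschetzPowTo η (N + 1 + 1) (2 * p) (2 * q) h2q c) := by
          rw [map_sub, map_smul,
            lefschetzPowTo_boxSum_succ_map_fst_of_sq_eq_zero η κ hκκ N
              (rfl : 2 * (p + 1) + 2 * N = 2 * (p + 1) + 2 * N) (by omega) (by omega) _,
            lefschetzPowTo_boxSum_cross_of_sq_eq_zero η κ hκκ (N + 1) (show 2 * p + 2 = 2 * (p + 1) by omega)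
              (show 2 * p + 2 * (N + 1) = 2 * (p + 1) + 2 * N by omega) (by omega) (by omega) c,
            lefschetzPowTo_comp_apply η (show 1 + (N + 1) = N + 1 + 1 by omega) _ _ h2q c,
            lefschetzPowTo_comp_apply η (show 1 + N = N + 1 by omega) _ _
              (show 2 * p + 2 * (N + 1) = 2 * (p + 1) + 2 * N by omega) c,
            Nat.cast_succ, add_sub_cancel_right]
        refine (h21c hXE hθ (p + 1) (N + 1) q (by omega) (by omega) _).2 ?_
        have h := hW
        rw [← hZW, lefschetzPowTo_eq_degCast] at h
        exact h
    -- (3) `(j+1) Z = j · v(c) + θ pr_X^* c`, `v(c)` θ-primitive: the primitive component `j · v(c)` is absolute Hodge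
    have hprim := primitiveLift_mem_primitiveClasses E η κ hE1 (p := p) (r := i) (by omega) hc
    have hjZ := hZ.smul_rat_of_canonical hN hXE (hexXE (p + 1)) ((i : ℚ) + 1 + 1)
    have hdec : ((((i : ℚ) + 1 + 1 : ℚ)) : ℂ) •
          (complexBetti.map (fst X E.X) (2 * (p + 1)) (lefschetzPowTo η 1 (2 * p) (2 * (p + 1)) (by omega) c) -
            (i : ℂ) • cupProduct (show 2 * p + 2 = 2 * (p + 1) by omega) (complexBetti.map (fst X E.X) (2 * p) c)
              (complexBetti.map (snd X E.X) 2 κ)) =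
        (((i + 1 : ℕ) : ℂ) •
          (lefschetzOperator (complexBetti.map (fst X E.X) 2 η) (two_add_two_mul p)
              (complexBetti.map (fst X E.X) (2 * p) c) -
            ((i + 1 : ℕ) : ℂ) • lefschetzOperator (complexBetti.map (snd X E.X) 2 κ) (two_add_two_mul p)
              (complexBetti.map (fst X E.X) (2 * p) c))) +
          lefschetzPowTo (complexBetti.map (fst X E.X) 2 η + complexBetti.map (snd X E.X) 2 κ) 1 (2 * p)
            (2 * (p + 1)) (by omega) (complexBetti.map (fst X E.X) (2 * p) c) := by
      rw [lefschetzOperator_map_fst_map_fst η (two_add_two_mul p) (by omega),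
        lefschetzOperator_map_snd_map_fst κ (two_add_two_mul p) (by omega),
        lefschetzPowTo_boxSum_one_map_fst η κ (show 2 * p + 2 * 1 = 2 * (p + 1) by omega) (by omega)]
      push_cast
      module
    have hv := isAbsoluteHodgeClass_primitiveComponent_of_canonical hN hex h21c hXE hθ (r := p) (p := p + 1) (j := i)
      rfl (by omega) hdec (Submodule.smul_mem _ _ hprim) hjZ
    -- divide by `j = i + 1`
    have h := hv.smul_rat_of_canonical hN hXE (hexXE (p + 1)) ((i + 1 : ℚ)⁻¹)
    rwa [smul_smul, show ((((i + 1 : ℚ)⁻¹ : ℚ)) : ℂ) * ((i + 1 : ℕ) : ℂ) = 1 by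
      push_cast; exact inv_mul_cancel₀ (by exact_mod_cast Nat.succ_ne_zero i), one_smul] at h

end Lift

/-! ## §2 Full Lefschetz stability of absolute Hodge classes (modulo (N)+(E)+(c)) -/

section Stable

/-- **`ηⁱ ∪ c` IS ABSOLUTE HODGE FOR A PRIMITIVE ABSOLUTE HODGE CLASS `c`, EVERY `i`** (modulo (N)+(E)+(c)): induction on
`i` run simultaneously over all smooth projective varieties — the lift `v(c)` is primitive absolute Hodge on `X × E` (§1),
so `θⁱ ∪ v(c)` is absolute Hodge there by the induction hypothesis, and its restriction to the slice `X × {t}` is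
`ηⁱ ∪ (η ∪ c) = η^{i+1} ∪ c` (`pr_E^* κ ↦ 0`). Degrees: `p + i = q`, `2p + 2i = 2q`.
[cite: Deligne1982HodgeCycles, §2 Example 2.1 (c), (d) (p. 16)] [cite: CharlesSchnell2014Notes, Prop. 11.2.7 and Cor. 11.2.12]
[cite: VoisinHodgeI2002, §6.2.3 Def. 6.24 and Thm. 6.25] -/
theorem isAbsoluteHodgeClass_lefschetzPowTo_of_mem_primitiveClasses_of_canonical (hN : chartConjugation_canonical)
    (hex : ∀ ⦃n : ℕ⦄ ⦃X : SchemeOver ℂ⦄, IsSmoothProjective n X →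
      ∀ (σ : ℂ ≃+* ℂ) (p : ℕ) (c : complexBetti X (2 * p)), ∃ s, IsConjugateClass σ X (2 * p) c s)
    (h21c : deligne1982_lefschetz_absoluteHodge_iff) :
    ∀ (i : ℕ) {n : ℕ} {X : SchemeOver ℂ}, IsSmoothProjective n X → ∀ {η : complexBetti X 2}, IsPolarizationClass n X η →
      ∀ {p j q : ℕ} (_ : 2 * p + j = n) (_ : p + i = q) (hm : 2 * p + 2 * i = 2 * q) {c : complexBetti X (2 * p)},
        c ∈ primitiveClasses η n (2 * p) → IsAbsoluteHodgeClass n X p c →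
          IsAbsoluteHodgeClass n X q (lefschetzPowTo η i (2 * p) (2 * q) hm c)
  | 0, n, X, hX, η, hη, p, j, q, hj, hq, hm, c, hc, hAH => by
    obtain rfl : q = p := by omega
    rwa [lefschetzPowTo_zero_apply]
  | i + 1, n, X, hX, η, hη, p, j, q, hj, hq, hm, c, hc, hAH => by
    rcases Nat.eq_zero_or_pos j with rfl | hj1
    · -- `c` is middle primitive: gen 70 (`n ≤ 2p + (i+1)`)
      exact isAbsoluteHodgeClass_lefschetzPowTo_of_canonical hN hex h21c hX hη (by omega) hq hm hAH
    obtain ⟨r, rfl⟩ : ∃ r, j = r + 1 := ⟨j - 1, by omega⟩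
    -- a polarised elliptic curve and the lift `v(c)` on `X × E`
    obtain ⟨E, hE1⟩ := exists_abelianVariety_dim_eq_one ℂ
    have hEsp : IsSmoothProjective E.dim E.X := AbelianVariety.isSmoothProjective_holds (A := E)
    obtain ⟨κ, hκ⟩ := exists_isPolarizationClass hEsp
    have hXE : IsSmoothProjective (n + E.dim) (X ⊗ E.X) := IsSmoothProjective.tensor_holds hX hEsp
    have hθ := isPolarizationClass_boxSum hX hEsp hη hκ
    have hv := isAbsoluteHodgeClass_primitiveLift_of_mem_primitiveClasses_of_canonical hN hex h21c hX hη E hE1 hκ hj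
      hc hAH
    have hvprim := primitiveLift_mem_primitiveClasses E η κ hE1 (p := p) (r := r) (by omega) hc
    -- induction hypothesis on `X × E`: `θⁱ v(c)` is absolute Hodge
    have hIH := isAbsoluteHodgeClass_lefschetzPowTo_of_mem_primitiveClasses_of_canonical hN hex h21c i hXE hθ
      (p := p + 1) (j := r) (q := q) (by omega) (by omega) (by omega) hvprim hv
    -- slice back: `s_t^* (θⁱ v(c)) = ηⁱ (η c) = η^{i+1} c`
    obtain ⟨t⟩ := hEsp.nonempty_algPoints ℂ
    have hs := absolutePullback_of_canonical hN hex hX hXE (sliceAt X t) q _ hIH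
    rwa [map_lefschetzPowTo, map_add, complexBetti_map_sliceAt_map_fst, map_sliceAt_map_snd_eq_zero X t two_ne_zero κ,
      add_zero, map_sub, map_smul, map_lefschetzOperator, map_lefschetzOperator, complexBetti_map_sliceAt_map_fst,
      complexBetti_map_sliceAt_map_fst, map_sliceAt_map_snd_eq_zero X t two_ne_zero κ,
      lefschetzOperator_apply (0 : complexBetti X 2), LinearMap.map_zero₂, smul_zero, sub_zero,
      lefschetzPowTo_lefschetzOperator η i (two_add_two_mul p) _ hm c] at hs

variable {n : ℕ} {X : SchemeOver ℂ}

/-- **ABSOLUTE HODGE CLASSES ARE STABLE UNDER EVERY POWER OF THE LEFSCHETZ OPERATOR OF EVERY POLARISATION** (modulo (N),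
(E) and Deligne's Ex. 2.1 (c)): for `X` smooth projective of dimension `n`, `η` a polarisation class, `a ∈ H^{2p}(X(ℂ); ℂ)`
absolute Hodge and ANY `N` (`p + N = q`), `ηᴺ ∪ a ∈ H^{2q}(X(ℂ); ℂ)` is absolute Hodge — gen 70's
`isAbsoluteHodgeClass_lefschetzPowTo_of_canonical` WITHOUT its threshold `n ≤ 2p + N`. Strong induction on `p`: beyond the
threshold gen 70; `p = 0`: every class in `H⁰` is primitive; else `a = a₀ + η ∪ a'` (first file) with `a₀` primitive
absolute Hodge (`ηᴺ a₀` by the primitive case) and `a'` absolute Hodge of codimension `p − 1` (`η^{N+1} a'` by induction).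
In print: Charles–Schnell Prop. 11.2.7 with 11.2.8 (1) for the correspondence `[H] ∪ ·`; none of (N), (E), (c) is
asserted. [cite: CharlesSchnell2014Notes, Prop. 11.2.7, Prop. 11.2.8 and Cor. 11.2.12]
[cite: Deligne1982HodgeCycles, §2 Example 2.1 (c), (d) (p. 16)] [cite: VoisinHodgeI2002, §6.2.3 Cor. 6.26 and Rem. 6.27] -/
theorem isAbsoluteHodgeClass_lefschetzPowTo_all_of_canonical (hN : chartConjugation_canonical)
    (hex : ∀ ⦃n : ℕ⦄ ⦃X : SchemeOver ℂ⦄, IsSmoothProjective n X →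
      ∀ (σ : ℂ ≃+* ℂ) (p : ℕ) (c : complexBetti X (2 * p)), ∃ s, IsConjugateClass σ X (2 * p) c s)
    (h21c : deligne1982_lefschetz_absoluteHodge_iff) (hX : IsSmoothProjective n X) {η : complexBetti X 2}
    (hη : IsPolarizationClass n X η) :
    ∀ (p : ℕ) {N q : ℕ} (_ : p + N = q) (hm : 2 * p + 2 * N = 2 * q) {a : complexBetti X (2 * p)},
      IsAbsoluteHodgeClass n X p a → IsAbsoluteHodgeClass n X q (lefschetzPowTo η N (2 * p) (2 * q) hm a) := by
  intro p
  induction p using Nat.strong_induction_on with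
  | _ p ih =>
    intro N q hq hm a ha
    by_cases hNn : n ≤ 2 * p + N
    · exact isAbsoluteHodgeClass_lefschetzPowTo_of_canonical hN hex h21c hX hη hNn hq hm ha
    obtain ⟨j, hj⟩ : ∃ j, 2 * p + j = n := ⟨n - 2 * p, by omega⟩
    rcases Nat.eq_zero_or_pos p with rfl | hp
    · -- `H⁰ = P⁰`: `η^{n+1} ∪ a ∈ H^{2n+2} = 0`
      have ha0 : a ∈ primitiveClasses η n (2 * 0) := by
        rw [primitiveClasses_eq_ker η n (show 2 * 0 ≤ n by omega) (show 2 * 0 + (n + 1) = n + 1 by omega)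
          (rfl : 2 * 0 + 2 * (n + 1) = 2 * 0 + 2 * (n + 1)), LinearMap.mem_ker]
        haveI := subsingleton_complexBetti hX (k := 2 * 0 + 2 * (n + 1)) (by omega)
        exact Subsingleton.elim _ _
      exact isAbsoluteHodgeClass_lefschetzPowTo_of_mem_primitiveClasses_of_canonical hN hex h21c N hX hη hj hq hm ha0 ha
    · obtain ⟨r, rfl⟩ : ∃ r, p = r + 1 := ⟨p - 1, by omega⟩
      obtain ⟨a₀, ha₀, a', haa⟩ := exists_mem_primitiveClasses_add_lefschetzPowTo hη (rfl : r + 1 = r + 1) hj a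
      have h₀ := isAbsoluteHodgeClass_primitiveComponent_of_canonical hN hex h21c hX hη rfl hj haa ha₀ ha
      have h' := isAbsoluteHodgeClass_lefschetzQuotient_of_canonical hN hex h21c hX hη rfl hj haa ha₀ ha
      have hL₀ := isAbsoluteHodgeClass_lefschetzPowTo_of_mem_primitiveClasses_of_canonical hN hex h21c N hX hη hj hq hm
        ha₀ h₀
      have hL' := ih r (by omega) (N := N + 1) (q := q) (by omega) (by omega) h'
      rw [haa, map_add, lefschetzPowTo_comp_apply η (show 1 + N = N + 1 by omega) _ hm (by omega) a']
      exact hL₀.add_of_canonical hN hX (fun σ d ↦ hex hX σ q d) hL'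

/-- **… in particular `η ∪ a` is absolute Hodge for EVERY absolute Hodge class `a` and EVERY polarisation class `η`**
(modulo (N)+(E)+(c)) — gen 70's `isAbsoluteHodgeClass_cupProduct_of_canonical` without its hypothesis `n ≤ 2p + 1`.
[cite: CharlesSchnell2014Notes, Prop. 11.2.7 and Cor. 11.2.12] [cite: Deligne1982HodgeCycles, §2 Example 2.1 (c), (d) (p. 16)] -/
theorem isAbsoluteHodgeClass_cupProduct_polarization_of_canonical (hN : chartConjugation_canonical)
    (hex : ∀ ⦃n : ℕ⦄ ⦃X : SchemeOver ℂ⦄, IsSmoothProjective n X →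
      ∀ (σ : ℂ ≃+* ℂ) (p : ℕ) (c : complexBetti X (2 * p)), ∃ s, IsConjugateClass σ X (2 * p) c s)
    (h21c : deligne1982_lefschetz_absoluteHodge_iff) (hX : IsSmoothProjective n X) {η : complexBetti X 2}
    (hη : IsPolarizationClass n X η) {p : ℕ} {a : complexBetti X (2 * p)} (ha : IsAbsoluteHodgeClass n X p a) :
    IsAbsoluteHodgeClass n X (p + 1) (cupProduct (two_add_two_mul p) η a) := by
  rw [← lefschetzPowTo_one_eq_cupProduct η (show 2 * p + 2 * 1 = 2 * (p + 1) by omega)]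
  exact isAbsoluteHodgeClass_lefschetzPowTo_all_of_canonical hN hex h21c hX hη p rfl _ ha

end Stable

/-! ## §3 Corollaries: exterior products with polarisation classes; ring2-b02's lift of ANY absolute Hodge class -/

section Cross

variable {n m : ℕ} {X T : SchemeOver ℂ}

/-- **THE EXTERIOR PRODUCT `pr_X^* a ∪ pr_T^* κ` OF AN ABSOLUTE HODGE CLASS WITH A POLARISATION CLASS OF ANY SMOOTH
PROJECTIVE `T` IS ABSOLUTE HODGE** (modulo (N)+(E)+(c)): for a polarisation class `η` of `X` and the box sum
`θ = pr_X^* η + pr_T^* κ` (a polarisation class of `X × T`, row b05), `θ ∪ pr_X^* a = pr_X^*(η ∪ a) + pr_X^* a ∪ pr_T^* κ`, and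
both `θ ∪ pr_X^* a` and `η ∪ a` are absolute Hodge by §2. [cite: CharlesSchnell2014Notes, Prop. 11.2.7 and Prop. 11.2.8]
[cite: Deligne1982HodgeCycles, §2 Example 2.1 (c), (d) (p. 16)] [cite: Andre1996Motifs, §1.3 (p. 12)] -/
theorem isAbsoluteHodgeClass_cross_polarization_of_canonical (hN : chartConjugation_canonical)
    (hex : ∀ ⦃n : ℕ⦄ ⦃X : SchemeOver ℂ⦄, IsSmoothProjective n X →
      ∀ (σ : ℂ ≃+* ℂ) (p : ℕ) (c : complexBetti X (2 * p)), ∃ s, IsConjugateClass σ X (2 * p) c s)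
    (h21c : deligne1982_lefschetz_absoluteHodge_iff) (hX : IsSmoothProjective n X) (hT : IsSmoothProjective m T)
    {κ : complexBetti T 2} (hκ : IsPolarizationClass m T κ) {p : ℕ} {a : complexBetti X (2 * p)}
    (ha : IsAbsoluteHodgeClass n X p a) :
    IsAbsoluteHodgeClass (n + m) (X ⊗ T) (p + 1)
      (cupProduct (show 2 * p + 2 = 2 * (p + 1) by omega) (complexBetti.map (fst X T) (2 * p) a)
        (complexBetti.map (snd X T) 2 κ)) := by
  obtain ⟨η, hη⟩ := exists_isPolarizationClass hX
  have hXT : IsSmoothProjective (n + m) (X ⊗ T) := IsSmoothProjective.tensor_holds hX hT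
  have hθ := isPolarizationClass_boxSum hX hT hη hκ
  have h₁ := isAbsoluteHodgeClass_lefschetzPowTo_all_of_canonical hN hex h21c hXT hθ p (N := 1) rfl
    (show 2 * p + 2 * 1 = 2 * (p + 1) by omega) (absolutePullback_of_canonical hN hex hXT hX (fst X T) p a ha)
  have h₂ := absolutePullback_of_canonical hN hex hXT hX (fst X T) (p + 1) _
    (isAbsoluteHodgeClass_lefschetzPowTo_all_of_canonical hN hex h21c hX hη p (N := 1) rfl
      (show 2 * p + 2 * 1 = 2 * (p + 1) by omega) ha)
  rw [lefschetzPowTo_boxSum_one_map_fst η κ _ (show 2 * p + 2 = 2 * (p + 1) by omega)] at h₁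
  have h := h₁.sub_of_canonical hN hXT (fun σ d ↦ hex hXT σ (p + 1) d) h₂
  rwa [add_sub_cancel_left] at h

/-- **ring2-b02's one-step lift `L_{pr_X^*η} pr_X^* a − s · L_{pr_E^*κ} pr_X^* a` of ANY absolute Hodge class `a` is absolute
Hodge, for every coefficient `s : ℕ`** (modulo (N)+(E)+(c); `η`, `κ` polarisation classes of `X` and of the abelian variety
`E`): both summands are, by §2 and the exterior-product corollary. This is the absolute-axis input of the defect induction
of AbelianAll XXVIII / ring2-b02 (primitivity for `s =` defect, rationality, Hodge type and descent of algebraicity are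
THEIRS). [cite: Kleiman1968AlgebraicCycles, §1.4 (1.4.6)] [cite: CharlesSchnell2014Notes, Prop. 11.2.7 and Cor. 11.2.12]
[cite: Deligne1982HodgeCycles, §2 Example 2.1 (c), (d) (p. 16)] -/
theorem isAbsoluteHodgeClass_primitiveLift_of_canonical (hN : chartConjugation_canonical)
    (hex : ∀ ⦃n : ℕ⦄ ⦃X : SchemeOver ℂ⦄, IsSmoothProjective n X →
      ∀ (σ : ℂ ≃+* ℂ) (p : ℕ) (c : complexBetti X (2 * p)), ∃ s, IsConjugateClass σ X (2 * p) c s)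
    (h21c : deligne1982_lefschetz_absoluteHodge_iff) (hX : IsSmoothProjective n X) {η : complexBetti X 2}
    (hη : IsPolarizationClass n X η) (E : AbelianVariety ℂ) {κ : complexBetti E.X 2}
    (hκ : IsPolarizationClass E.dim E.X κ) {p : ℕ} {a : complexBetti X (2 * p)} (ha : IsAbsoluteHodgeClass n X p a)
    (s : ℕ) :
    IsAbsoluteHodgeClass (n + E.dim) (X ⊗ E.X) (p + 1)
      (lefschetzOperator (complexBetti.map (fst X E.X) 2 η) (two_add_two_mul p) (complexBetti.map (fst X E.X) (2 * p) a) -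
        ((s : ℕ) : ℂ) • lefschetzOperator (complexBetti.map (snd X E.X) 2 κ) (two_add_two_mul p)
          (complexBetti.map (fst X E.X) (2 * p) a)) := by
  have hEsp : IsSmoothProjective E.dim E.X := AbelianVariety.isSmoothProjective_holds (A := E)
  have hXE : IsSmoothProjective (n + E.dim) (X ⊗ E.X) := IsSmoothProjective.tensor_holds hX hEsp
  rw [lefschetzOperator_map_fst_map_fst η (two_add_two_mul p) (by omega),
    lefschetzOperator_map_snd_map_fst κ (two_add_two_mul p) (by omega)]
  refine (absolutePullback_of_canonical hN hex hXE hX (fst X E.X) (p + 1) _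
    (isAbsoluteHodgeClass_lefschetzPowTo_all_of_canonical hN hex h21c hX hη p (N := 1) rfl _ ha)).sub_of_canonical hN hXE
    (fun σ d ↦ hex hXE σ (p + 1) d) ?_
  have h := (isAbsoluteHodgeClass_cross_polarization_of_canonical hN hex h21c hX hEsp hκ ha).smul_rat_of_canonical hN
    hXE (fun σ d ↦ hex hXE σ (p + 1) d) (s : ℚ)
  rwa [Rat.cast_natCast] at h

end Cross

/-! ## Audit: nothing is decided here

No theorem above concludes `AbsoluteHodgeImpliesAlgebraicAV`, `AbsoluteHodgeImpliesAlgebraic`, `HC_AV` or `HC_CM`; every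
statement carries the undischarged hypotheses (N) `chartConjugation_canonical`, (E) (existence of conjugates) and (c)
`deligne1982_lefschetz_absoluteHodge_iff`, named facts of the tree displayed as hypotheses and never asserted. Axiom
closures: the three standard axioms. -/

#print axioms Summit.HodgeConjecture.HodgeConjecture.Ring2.Hypotheses.isAbsoluteHodgeClass_lefschetzPowTo_all_of_canonical
#print axioms Summit.HodgeConjecture.HodgeConjecture.Ring2.Hypotheses.isAbsoluteHodgeClass_primitiveLift_of_canonical

end Summit.HodgeConjecture.HodgeConjecture.Ring2.Hypotheses

end
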